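import Mathlib
import HarnessLib
import HarnessLib.Audit
import Summits.MatrixMultiplication.Statement
import Literature.Computability.AlgebraicComplexity.MatrixMultiplicationExponent
import Literature.Computability.AlgebraicComplexity.TensorRankFactsProofs
import HarnessLib.Audit.Status.Attr

/-!
Route: TaftSchemes

DORMANT since 2026-08-23T00:15:07Z (reconciler: no traction for 5.8 d (last activity item-evidence-added at 2026-08-17T04:52:35Z); parked, not closed — `ledger route dormant route-MatrixMultiplication-TaftSchemes --off` to reactivate) — unstaffed, not closed; items shared with open routes are served there. `ledger route dormant <id> --off` reactivates.

# Route TaftSchemes — quantum-Borel (Taft) symmetric bilinear schemes reach exponent two; Strassen's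
seven already span a Sweedler module

Let the Taft algebra T_n(ω), ω = exp(2πi/n) (n = 2: Sweedler's H_4 = the quantum Borel u_i(𝔟) of
u_q(𝔰𝔩_2) at q = i, the
parameter at which the natural representation has quantum dimension [2]_q = 0), act on M_n(ℂ) as a
module algebra by g = Ad(D),
D = diag(ω^0,…,ω^(n-1)), and the (1,g)-twisted inner derivation δ(Y) = YN − N·g(Y), N = Σ_j
e_(j,j+1); write 𝒦, 𝒳 for the induced
operators on bilinear maps M_n × M_n → M_n, (𝒦f)(A,B) = g(f(g⁻¹A,g⁻¹B)), (𝒳f)(A,B) = δ(f(g⁻¹A,g⁻¹B))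
− f(δg⁻¹A,B) − f(g⁻¹A,δg⁻¹B)
(matrix multiplication is invariant: 𝒦m = m, 𝒳m = 0). A TAFT-STABLE SCHEME of length r is a
decomposition of ⟨n,n,n⟩ into r triads
whose span is carried into itself by 𝒦 and 𝒳 (a T_n-submodule of Hom(M_n⊗M_n, M_n)). It suffices to
show X = Thesis = TaftSeedSchemes ∧ TaftThree: the
DESIGN statement (for every ε > 0 some ⟨n,n,n⟩ is an orbit sum of ≤ n^(1+ε)·… δ-closed rank-one
seeds plus Taft-invariant terms, n·s + r₀ ≤
n^(2+ε) — giving a Taft-stable scheme of that length, support TaftExponentTwo/SeedToScheme) together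
with the first finite rung n = 3 (length ≤ 23) of the ladder (the second
rung n = 4, length ≤ 48, is support TaftFour48). X → ω(ℂ) = 2 by rank ≤ n·s + r₀ (glue `closes`,
certified).
No card is realised (novel-route, lens move37); the operators are inlined in every item (definition
request TaftOperators below).
Lean: `(let wt : (n : ℕ) → Fin n × Fin n → ℂ := fun n p => Complex.exp (2 * Real.pi * Complex.I / n)
^ ((p.1 : ℤ) - (p.2 : ℤ)); let tr := fun {n : ℕ} (w u v : Fin n × Fin n → ℂ) =>
Literature.Computability.AlgebraicComplexity.triad w u v; let mm := fun n : ℕ =>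
Literature.Computability.AlgebraicComplexity.matMulTensor ℂ n n n; let K := fun (n : ℕ) (t : (Fin n
× Fin n → Fin n × Fin n → Fin n × Fin n → ℂ)) (a b c : Fin n × Fin n) => wt n a * (wt n b)⁻¹ * (wt n
c)⁻¹ * t a b c; let X := fun (n : ℕ) (t : (Fin n × Fin n → Fin n × Fin n → Fin n × Fin n → ℂ)) (a b
c : Fin n × Fin n) => (wt n b)⁻¹ * (wt n c)⁻¹ * ((∑ l : Fin n, if (l : ℕ) + 1 = (a.2 : ℕ) then t
(a.1, l) b c else 0) - ∑ l : Fin n, if (a.1 : ℕ) + 1 = (l : ℕ) then wt n (l, a.2) * t (l, a.2) b c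
else 0) - (wt n b)⁻¹ * ((∑ μ : Fin n, if (b.2 : ℕ) + 1 = (μ : ℕ) then t a (b.1, μ) c else 0) - ∑ k :
Fin n, if (k : ℕ) + 1 = (b.1 : ℕ) then wt n b * t a (k, b.2) c else 0) - (wt n b)⁻¹ * (wt n c)⁻¹ *
((∑ μ : Fin n, if (c.2 : ℕ) + 1 = (μ : ℕ) then t a b (c.1, μ) else 0) - ∑ k : Fin n, if (k : ℕ) + 1
= (c.1 : ℕ) then wt n c * t a b (k, c.2) else 0); ∀ ε : ℝ, 0 < ε → ∃ n : ℕ, 2 ≤ n ∧ ∃ s r₀ : ℕ, ((n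
* s + r₀ : ℕ) : ℝ) ≤ (n : ℝ) ^ (2 + ε) ∧ ∃ (w u v : Fin s → Fin n × Fin n → ℂ) (w' u' v' : Fin r₀ →
Fin n × Fin n → ℂ), (∀ j, ∃ c : Fin n → ℂ, X n (tr (w j) (u j) (v j)) = ∑ k : Fin n, c k • ((K
n)^[(k : ℕ)]) (tr (w j) (u j) (v j))) ∧ (∀ i, K n (tr (w' i) (u' i) (v' i)) = tr (w' i) (u' i) (v'
i) ∧ X n (tr (w' i) (u' i) (v' i)) = 0) ∧ mm n = (∑ j, ∑ k : Fin n, ((K n)^[(k : ℕ)]) (tr (w j) (u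
j) (v j))) + ∑ i, tr (w' i) (u' i) (v' i)) ∧ (let wt : (n : ℕ) → Fin n × Fin n → ℂ := fun n p =>
Complex.exp (2 * Real.pi * Complex.I / n) ^ ((p.1 : ℤ) - (p.2 : ℤ)); let tr := fun {n : ℕ} (w u v :
Fin n × Fin n → ℂ) => Literature.Computability.AlgebraicComplexity.triad w u v; let mm := fun n : ℕ
=> Literature.Computability.AlgebraicComplexity.matMulTensor ℂ n n n; let K := fun (n : ℕ) (t : (Fin
n × Fin n → Fin n × Fin n → Fin n × Fin n → ℂ)) (a b c : Fin n × Fin n) => wt n a * (wt n b)⁻¹ * (wt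
n c)⁻¹ * t a b c; let X := fun (n : ℕ) (t : (Fin n × Fin n → Fin n × Fin n → Fin n × Fin n → ℂ)) (a
b c : Fin n × Fin n) => (wt n b)⁻¹ * (wt n c)⁻¹ * ((∑ l : Fin n, if (l : ℕ) + 1 = (a.2 : ℕ) then t
(a.1, l) b c else 0) - ∑ l : Fin n, if (a.1 : ℕ) + 1 = (l : ℕ) then wt n (l, a.2) * t (l, a.2) b c
else 0) - (wt n b)⁻¹ * ((∑ μ : Fin n, if (b.2 : ℕ) + 1 = (μ : ℕ) then t a (b.1, μ) c else 0) - ∑ k :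
Fin n, if (k : ℕ) + 1 = (b.1 : ℕ) then wt n b * t a (k, b.2) c else 0) - (wt n b)⁻¹ * (wt n c)⁻¹ *
((∑ μ : Fin n, if (c.2 : ℕ) + 1 = (μ : ℕ) then t a b (c.1, μ) else 0) - ∑ k : Fin n, if (k : ℕ) + 1
= (c.1 : ℕ) then wt n c * t a b (k, c.2) else 0); let St := fun (n r : ℕ) (w u v : Fin r → Fin n ×
Fin n → ℂ) => mm n = ∑ s, tr (w s) (u s) (v s) ∧ (∃ c : Fin r → Fin r → ℂ, ∀ s, K n (tr (w s) (u s)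
(v s)) = ∑ s', c s s' • tr (w s') (u s') (v s')) ∧ (∃ c : Fin r → Fin r → ℂ, ∀ s, X n (tr (w s) (u
s) (v s)) = ∑ s', c s s' • tr (w s') (u s') (v s')); ∃ r : ℕ, r ≤ 23 ∧ ∃ (w u v : Fin r → Fin 3 ×
Fin 3 → ℂ), St 3 r w u v)`

## Assembly
Pure logic plus proved tree facts: the orbit-sum decomposition of TaftSeedSchemes is a decomposition
into s·n + r₀ triads (the diagonal operator 𝒦
acts leg by leg, so its iterates send triads to triads), so R(⟨n,n,n⟩) ≤ s·n + r₀
(`tensorRank_le_card_of_eq_sum`), ω(ℂ) ≤ log_n r ≤ 2 + ε (Bläser 2013 Thm 5.9 in cubic form,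
`omega_le_logb_of_rank_le' Blaser2013Thm59_holds` — a DISCHARGED fact,
KroneckerRank/TensorRankFactsProofs — and `Real.logb_rpow`) for
every ε > 0, hence ω(ℂ) ≤ 2, and ω(ℂ) = 2 by `omega_two_le` (FlatteningBound) and
`MatrixMultiplication_iff`; route imports narrowed (rev 1) to MatrixMultiplicationExponent +
TensorRankFactsProofs — no Literature named fact is load-bearing. The deciding
theorem `closes (hS : TaftSeedSchemes) : MatrixMultiplication` (CRUX-ONLY shape: its one binder is
the rank-2 crux; the re-indexing
𝒦^k(triad) = triad and the count |(Fin s × Fin n) ⊕ Fin r₀| = s·n + r₀ are proved inside it) is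
kernel-checked (glue.lean, no sorry; natively certified at open and again at rev 1).
Only the first conjunct of X is used logically; TaftThree (crux) and TaftFour48 (support) are the
finite rungs that make the line falsifiable now; TaftClosureFree (support) records that the span
form is equivalent to the summit; TaftTwo, TaftInvariant are calibration.

Rationale: WHY THIS LINE. MOVE 37: fast-matrix-multiplication schemes are designed and classified by GROUP
symmetry (DeGroote1978, Burichenko2014 =
arXiv:1408.6273, GrochowMoore2017 = arXiv:1708.09398,
ChiantiniHauensteinIkenmeyerLandsbergOttaviani2018, BallardEtAl2018 =
arXiv:1801.00843, HeuleKauersSeidl2021); nobody has asked for NON-SEMISIMPLE (Hopf, quantum-group)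
symmetry, although ⟨n,n,n⟩ is
invariant under the quantum Borel of U_q(𝔤𝔩_n)^⊗3 acting through the coproduct, and at roots of
unity ([n]_q = 0) the Reynolds
operator that makes group symmetry cost orbits does not exist. Evidence found by this unit (exact
arithmetic over ℚ(i),
compute/quantum_strassen_exact.py, taft_tensor.py, witness_tafttwo.py): at one point of its isotropy
orbit STRASSEN'S SCHEME SPANS A
SWEEDLER MODULE 𝟙 ⊕ P ⊕ P ⊕ P (𝒦 fixes t1 and swaps the three pairs of Strassen's diagonal Z_2; 𝒳t1
= 0, 𝒳t2 = −(t2+t5)/2 = −𝒳t5,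
𝒳t3 = (t3+t4)/2 = −𝒳t4, 𝒳t6 = −(t6+t7)/2 = −𝒳t7; MaMu = sum of socles), while (controls) generic
Z_2-pairs of rank-one tensors are
NOT 𝒳-stable (relative defect 0.6–0.95), the gl_2^3 isotropy Lie algebra stabilising the span is
trivial and 𝒳 is far (relative
distance 0.9) from the span of infinitesimal isotropies — the symmetry is genuinely quantum, not a
group symmetry in disguise; the
opposite Borel (F) and the q = ζ_3, ζ_6 alignments with Strassen's order-3 diagonal symmetry fail.
Imported area: actions of pointed
(non-semisimple) Hopf algebras on central simple algebras (Montgomery1993Hopf Ch. 4, 7;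
EtingofWalton2014 = arXiv:1403.4673; Taft /
Nakayama module theory: projectives of T_n are the n-dimensional uniserials, so a Taft-stable scheme
= rank-one SEEDS whose
Z_n-orbit is δ-closed, MaMu = Σ socles). What it does that no listed route does: a new symmetry TYPE
for the ansatz (all symmetric-
scheme routes — SchurWeylEquivariant, StabilizerTensorRank, PauliSmithLocalisation, the
group/Young/Lie design routes — use groups),
with a verified n = 2 instance and a finite n = 3, 4 ladder (kit job j019146 running the n = 3
search).

RANKED CRUXES. #0 Thesis (target) — X = TaftSeedSchemes ∧ TaftThree (the asymptotic design statement
and the first open rung of the Taft ladder; each conjunct is the crux of the same name below). (why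
it might fail: like every symmetric ansatz it may be bounded away from optimal — Taft-closure is
codimension 5 (of 12) per seed already at n = 2 — and the n = 3 rung may be false at its threshold
23 even if the asymptotics hold.) [Strassen1969, DeGroote1978, arXiv:1408.6273, arXiv:1708.09398,
Montgomery1993Hopf]
#2 TaftSeedSchemes (crux) — the DESIGN form of X (orbit sums of δ-closed seeds): for every ε > 0
there are n ≥ 2, s seeds and r₀ invariant terms with n·s + r₀ ≤ n^(2+ε), rank-one tensors t_j (j <
s) each Taft-CLOSED (𝒳 t_j ∈ span of its Z_n-orbit 𝒦^k t_j, k < n — a projective uniserial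
T_n-module) and rank-one Taft-INVARIANT tensors t'_i (𝒦 t'_i = t'_i, 𝒳 t'_i = 0), with ⟨n,n,n⟩ = Σ_j
Σ_k 𝒦^k t_j + Σ_i t'_i. (Strassen at n = 2: s = 3, r₀ = 1, the identity term.) Implies X by support
SeedToScheme (𝒦^n = id and 𝒳𝒦 = ω𝒦𝒳 on tensors, checked). [difficulty: open-problem] (why it might
fail: counting: s ≤ n^(1+ε) seeds must supply n³ − r₀ support cells through orbits of length n while
δ-closure (codimension 5 of 12 per seed at n = 2) is imposed; invariant rank-ones are scarce
(weight-zero, δ-killed), so r₀ = n^(2+ε) of them may not exist either.) [Strassen1969,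
arXiv:1708.09398, arXiv:1801.00843, Montgomery1993Hopf]
#3 TaftThree (crux) — sign of life at n = 3 (ω_3 = e^(2πi/3)): ⟨3,3,3⟩ has a Taft-stable scheme of
length ≤ 23 (Laderman's count; rank ∈ [19,23] open). Equivalently some rank-≤23 decomposition has,
at a point of its PGL_3^3-isotropy orbit, a span stable under Ad(diag(1,ω,ω²))-twisting and the
twisted derivation by e_12 + e_23 — first test: the BallardEtAl2018 families with Z_3 and Z_4 × Z_3
symmetry, then the orbit-sum/closure search (kit job j019146: s seeds with δ-closed Z_3-orbits + r0
invariant terms, r = 3s + r0 ∈ (27, 23, 21, 19)). [difficulty: M] (why it might fail: BILR's Z_3 is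
the cyclic permutation of the three factors, not a diagonal conjugation of order 3; no rank-23
scheme may admit the diagonal order-3 alignment at all, let alone δ-closure (then the ladder starts
only at a longer length, and 24–27 is the informative window).) [Laderman1976, arXiv:1801.00843,
Smirnov2013, HeuleKauersSeidl2021]
#9 ThesisOfCruxes (support) — composition glue: the two cruxes give the target (conjunction
introduction). [difficulty: provable-now] [Strassen1969]
#9 TaftExponentTwo (support) — the SPAN form of the design statement: for every ε > 0 some ⟨n,n,n⟩
(n ≥ 2) has a Taft-stable scheme (span of the triads stable under 𝒦 and 𝒳) of length r ≤ n^(2+ε);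
implied by TaftSeedSchemes (SeedToScheme) and itself implying ω(ℂ) = 2 (rank ≤ r; this unit's
Sketch2.lean proves TaftExponentTwo → MatrixMultiplication sorry-free). [difficulty: open-problem]
[Strassen1969, Blaser2013]
#9 SeedToScheme (support) — glue to the target: TaftSeedSchemes → TaftExponentTwo (the n·s + r₀
tensors 𝒦^k t_j, t'_i are triads — 𝒦 acts diagonally leg by leg — they sum to ⟨n,n,n⟩, and their
span is 𝒦-stable (𝒦^n = id) and 𝒳-stable (𝒳𝒦 = ω𝒦𝒳, closure of the seeds, 𝒳 t'_i = 0)). [difficulty: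
provable-now] [Montgomery1993Hopf, Strassen1969]
#9 TaftClosureFree (support) — (equivalence with the summit; open-problem, not for provers)
quantum-Borel symmetry is asymptotically free: for every ε > 0 and infinitely many n, SOME
decomposition of ⟨n,n,n⟩ of length ≤ n^ε·R(⟨n,n,n⟩) is Taft-stable (so X ⟺ ω = 2; the T_n-analogue
of the symmetrisation question behind SchurWeylEquivariant's SymmetrisationCheap, for a 2n-…
n²-dimensional NON-semisimple algebra instead of S_N). [difficulty: open-problem] [arXiv:1705.08740,
arXiv:1801.00843, arXiv:1408.6273, Montgomery1993Hopf]
#9 TaftFour48 (support) — second rung (support; staffed by anyone idle): ⟨4,4,4⟩ (ω_4 = i) has a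
Taft-stable scheme of length ≤ 48 < 49 = 7²: the first square format below Strassen's power, where
the record length-48 schemes over ℂ (AlphaEvolve 2025, coefficients in ℤ[i]/2) are genuinely complex
— and i is exactly the Taft parameter at n = 4. First test: the stabiliser of the published
48-scheme (arXiv:2506.13131 and its successors) for an order-4 diagonal element, then the closure
search. [difficulty: M] [arXiv:2506.13131, Strassen1969, arXiv:1408.6273]
#9 TaftTwo (support) — Strassen's scheme is Taft-stable at n = 2: the explicit rational witness
(NOTES.md of this unit; entries in {0, ±1, ±1/2}) sums to ⟨2,2,2⟩, 𝒦 permutes its terms (t1 fixed;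
t2↔t5, t3↔t4, t6↔t7) and 𝒳t1 = 0, 𝒳t2 = −(t2+t5)/2 = −𝒳t5, 𝒳t3 = (t3+t4)/2 = −𝒳t4, 𝒳t6 = −(t6+t7)/2
= −𝒳t7 (span ≅ 𝟙 ⊕ P³ over Sweedler's H_4). A finite identity over ℚ once exp(2πi/2) = −1 is
rewritten; verified exactly outside Lean. [difficulty: provable-now] [Strassen1969,
arXiv:1708.09398, Montgomery1993Hopf]
#9 TaftInvariant (support) — matrix multiplication is Taft-invariant for every n: 𝒦 m = m (weights
telescope on the support pattern) and 𝒳 m = 0 (the twisted Leibniz rule δ(PQ) = δ(P)g(Q) + Pδ(Q)).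
[difficulty: provable-now] [Montgomery1993Hopf, arXiv:1403.4673]

TWO-LAYER PLAN. TaftSeedSchemes ⇐ SeedSupply → ResidualInvariant → TaftSeedSchemes (SeedSupply: for
every ε and infinitely many n, s ≤ n^(1+ε)
δ-closed seeds whose orbit sums leave a Taft-INVARIANT residual ⟨n,n,n⟩ − Σ orbit sums;
ResidualInvariant: every Taft-invariant tensor in the
support closure has rank ≤ n^(2+ε) realised by invariant rank-ones; k = 2, depth 1). TaftThree ⇐ (a
BILR-family alignment lemma) → (closure certificate) → TaftThree. Nothing filed now.

KILL CRITERIA. A proof that NO Taft-stable scheme of ⟨3,3,3⟩ of length ≤ 27 exists (refuting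
TaftThree strongly: not even the trivial length) shows
the n = 2 module is an accident of Strassen's orbit — pivot to the product-Borel variant
(u_i(𝔟)^⊗k-stable schemes of ⟨2^k⟩ shorter
than 7^k, the quantum sibling of SchurWeylEquivariant's EquivariantBeatsStrassenPower) or close
`refuted:TaftThree` if that variant is
also empty at k = 2 (length ≤ 48). A theorem 'T_n-stable schemes have length ≥ c·n^(2+δ)' refutes
TaftClosureFree and the route
(the support TaftClosureFree is then refuted and the route closes refuted:TaftSeedSchemes once
SeedSupply is shown impossible). ω = 2 proved elsewhere moots the target but not the structural
cruxes.

NOT DECOMPOSED YET. The split of TaftSeedSchemes into seed supply and invariant residual (layer 2),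
the classification of δ-closed rank-one seeds (an explicit affine variety; at n = 2 of local
dimension 7 in the 12-dimensional space of triples (w,u,v)), the choice of Borel (positive vs
negative; full quantum Borel of 𝔤𝔩_n
with n − 1 twisted derivations vs the rank-one Taft algebra used here), and other roots of unity —
all deliberately left open until
TaftThree reports which variant lives at n = 3.

CHEAPEST FALSIFIER. The n = 3 search itself (kit job j019146, compute/taft_search_job.py:
least-squares for MaMu = Σ_j Σ_k 𝒦^k t_j + Σ_i t'_i with
closure 𝒳 t_j ∈ span(𝒦^k t_j) and invariant t'_i, r ∈ (27, 23, 21, 19), baseline = plain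
Z_3-diagonal-symmetric schemes whose
closure defect is then measured): if even r = 27 admits no Taft-stable scheme while plain
Z_3-symmetric ones abound, the quantum
closure is an n = 2 coincidence and the line is dead at its second rung. Run so far: n = 2 — the
ansatz re-finds Strassen-type
Taft-stable schemes (support TaftTwo verified exactly); n = 3 — δ-closed rank-one seeds EXIST (a
local Nelder–Mead search from random
starts reaches closure defect 1e-10, compute/seed_n3.py), so the orbit-sum ansatz has building
blocks at n = 3; the scheme search is queued.

NUMBERS. R(⟨2,2,2⟩) = bR = 7 (Strassen1969, Winograd1971, HopcroftKerr1971; Landsberg 2006);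
R(⟨3,3,3⟩) ∈ [19, 23] (Bläser; Laderman1976),
bR(⟨3,3,3⟩) ∈ [17, 20] (Conner–Harper–Landsberg 2023; Smirnov2013); R(⟨4,4,4⟩) ≤ 48 over ℂ
(arXiv:2506.13131), 49 = 7² over ℚ…;
ω < 2.3714 (tree: advxxz2025). Symmetry groups: Aut(Strassen) ≅ S_3 × S_3 (arXiv:1408.6273; the
diagonal S_3 = ⟨swap, [[0,−1],[1,−1]]⟩
verified here); dim T_n = n², projectives of T_n have dimension n; at n = 2 the seed variety {t rank
one : 𝒳t ∈ span(t, 𝒦t)} has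
local dimension 7 of 12 (this unit, compute/seed_variety.py). The schoolbook n³-scheme is 𝒦-stable
termwise but has 𝒳-defect exactly 1 at n = 2, 3 (compute/standard_scheme_check.py): Taft-stability
separates Strassen's scheme from the schoolbook one already at n = 2, and padding with cancelling
pairs shows Taft-stable schemes of length ≤ n³ + 2n⁶ always exist, so only the LENGTH carries
content.

DEFINITION REQUESTS. TaftOperators (topic
Summits/MatrixMultiplication/MatrixMultiplication/Theorems): name the inlined objects of the items —
`rootOfUnity n`,
`taftWeight n p = ω^(p.1−p.2)`, `taftK n`, `taftX n` (the index formulas of § Thesis, cross-checked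
against the bilinear-map definition
in compute/taft_tensor.py and compute/lean_formula_check.py), `IsSpanStable`, `IsTaftStableScheme` —
exactly as in this unit's
Sketch.lean, so that each item is `Iff.rfl`-equal to its named form (pattern of
OctonionicLaserDefs). No Literature fact is needed.

Novelty: Searches (2026-08-16): zbMATH `quantum group symmetry Strassen algorithm matrix multiplication` (0
relevant), `Hopf algebra
symmetries fast matrix multiplication algorithm` (0), `symmetries of Strassen algorithm Burichenko`
(2: arXiv:1408.6273,
arXiv:1508.01110 — group symmetries only), `Polya-Carlson tensor rank` (0), `star-triangle relation
tensor rank` (0); local `lit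
search` daemon and OpenAlex/S2 were unavailable (rc 1 / HTTP 429) during the session; tree-side:
grep of all 65 Theses and ~175 idea
cards of the sub for `Hopf|quantum group|U_q|Taft|Sweedler|root of unity` — hits only for unrelated
uses (quantum PLANE host card
quantum-plane-thermometer, closed vacuous; SU(2)/Heisenberg cards); `ledger negatives` (6 refuted
statements, none about symmetric
schemes). Nearest prior art found: arXiv:1708.09398 (Grochow–Moore: Strassen's scheme as a GROUP
orbit / unitary 2-design) and
arXiv:1408.6273, arXiv:1801.00843 (group stabilisers of schemes; BILR's symmetric 3×3 searches); on
the Hopf side Montgomery1993Hopf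
/ arXiv:1403.4673 (Taft and pointed-Hopf actions on matrix and division algebras) — never applied to
bilinear complexity.
Delta: replaces the symmetry GROUP of a scheme by a non-semisimple Hopf algebra acting through its
coproduct (the quantum Borel at
[n]_q = 0), exhibits the first instance (Strassen's seven span the Sweedler module 𝟙 ⊕ P³, exact
over ℚ(i), with controls showing it
is not a group symmetry), and poses exponent two for Taft-stable schemes with a finite  [refs: 1408.6273, 1508.01110, 1708.09398, 1801.00843, 1403.4673]

Barriers (technique_class: quantum-borel-ansatz, symmetric-decomposition): - technique_class: quantum-borel-ansatz, symmetric-decomposition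
- Literature.Barriers.MatrixMultiplication.InfimumNotMinimumBarrier: respected — X quantifies over
all ε with n free; no single n certifies ω = 2 (each rung only gives ω ≤ log_n r).
- Literature.Barriers.MatrixMultiplication.IrreversibilityBarrier: not in its class — no
intermediate tensor is powered; schemes decompose ⟨n,n,n⟩ itself (the same holds for
UniversalMethodBarrier, UnstableTensorBarrier, RectangularBarrier).
- Literature.Barriers.MatrixMultiplication.TricoloredSumFreeBarrier: not in its class — the cyclic
group ⟨𝒦⟩ ≅ Z_n is a SYMMETRY of the scheme, not a host; no STPP/TPP packing is used (likewise
NilpotentGroupBarrier, YoungSubgroupBarrier, QuasirandomBarrier, NormalizerBarrier, GradedPacking,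
BoundedRankFrameBarrier, EquivoluminousBarrier).
- Literature.Barriers.MatrixMultiplication.LinearRankMethodBarrier: an upper-bound line; no
lower-bound method is invoked.
- Uncatalogued 'price of symmetry' notes (closed cards symmetry-paid-in-orbits,
representation-stability-FI, unitary-3-design no-free-lunch): they price GROUP averaging /
naturality in n; a Taft-stable span is not an orbit union and T_n has no Reynolds operator ([n]_q =
0), and the ansatz is not natural in n — outside their class; the bet is that non-semisimplicity is
what lets symmetric spans stay small.
- Negatives index: the 6 refuted statements of the summit (ThinBlockAlpha RectangularThmB,
SnThresholdCensus ThresholdSubgroupTriples, Le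

History (route lifecycle, newest last):
- 2026-08-23T00:15:07Z · DORMANT — reconciler: no traction for 5.8 d (last activity item-evidence-added at 2026-08-17T04:52:35Z); parked, not closed — `ledger route dormant route-MatrixMultiplica (operator:999:1608132)

sub-problem: MatrixMultiplication · status: dormant · opened planner-plan-lens-MatrixMultiplication-move37-v2-g2-0 2026-08-16T17:43:02Z · rev 2 · ledger route-MatrixMultiplication-TaftSchemes
GENERATED by the gate from the ledger (D-0016/17). Provers cite these decls: `theorem foo : Summit.MatrixMultiplication.MatrixMultiplication.Theses.TaftSchemes.<Decl> := …` in Summits/MatrixMultiplication/MatrixMultiplication/Theorems/<Name>.lean.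
-/

namespace Summit.MatrixMultiplication.MatrixMultiplication.Theses.TaftSchemes

open scoped BigOperators Topology Manifold Classical MeasureTheory ProbabilityTheory Matrix InnerProductSpace ComplexConjugate ContinuousMap
open Filter Set Function TopologicalSpace MeasureTheory

attribute [summit_statement] _root_.MatrixMultiplication

/-- item stmt-MatrixMultiplication-16129 · target · rank 0 · open · by planner
why it might fail: like every symmetric ansatz it may be bounded away from optimal — Taft-closure is codimension 5 (of 12) per seed already at n = 2 — and the n = 3 rung may be false at its threshold 23 even if the asymptotics hold.
sources: Strassen1969, DeGroote1978, arXiv:1408.6273, arXiv:1708.09398, Montgomery1993Hopf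
[target] X = TaftSeedSchemes ∧ TaftThree (the asymptotic design statement and the first open rung of
the Taft ladder; each conjunct is the crux of the same name below). -/
@[route_item "route-MatrixMultiplication-TaftSchemes"]
def Thesis : Prop :=
  (let wt : (n : ℕ) → Fin n × Fin n → ℂ := fun n p => Complex.exp (2 * Real.pi * Complex.I / n) ^ ((p.1 : ℤ) - (p.2 : ℤ)); let tr := fun {n : ℕ} (w u v : Fin n × Fin n → ℂ) => Literature.Computability.AlgebraicComplexity.triad w u v; let mm := fun n : ℕ => Literature.Computability.AlgebraicComplexity.matMulTensor ℂ n n n; let K := fun (n : ℕ) (t : (Fin n × Fin n → Fin n × Fin n → Fin n × Fin n → ℂ)) (a b c : Fin n × Fin n) => wt n a * (wt n b)⁻¹ * (wt n c)⁻¹ * t a b c; let X := fun (n : ℕ) (t : (Fin n × Fin n → Fin n × Fin n → Fin n × Fin n → ℂ)) (a b c : Fin n × Fin n) => (wt n b)⁻¹ * (wt n c)⁻¹ * ((∑ l : Fin n, if (l : ℕ) + 1 = (a.2 : ℕ) then t (a.1, l) b c else 0) - ∑ l : Fin n, if (a.1 : ℕ) + 1 = (l : ℕ) then wt n (l, a.2)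 * t (l, a.2) b c else 0) - (wt n b)⁻¹ * ((∑ μ : Fin n, if (b.2 : ℕ) + 1 = (μ : ℕ) then t a (b.1, μ) c else 0) - ∑ k : Fin n, if (k : ℕ) + 1 = (b.1 : ℕ) then wt n b * t a (k, b.2) c else 0) - (wt n b)⁻¹ * (wt n c)⁻¹ * ((∑ μ : Fin n, if (c.2 : ℕ) + 1 = (μ : ℕ) then t a b (c.1, μ) else 0) - ∑ k : Fin n, if (k : ℕ) + 1 = (c.1 : ℕ) then wt n c * t a b (k, c.2) else 0); ∀ ε : ℝ, 0 < ε → ∃ n : ℕ, 2 ≤ n ∧ ∃ s r₀ : ℕ, ((n * s + r₀ : ℕ) : ℝ) ≤ (n : ℝ) ^ (2 + ε) ∧ ∃ (w u v : Fin s → Fin n × Fin n → ℂ) (w' u' v' : Fin r₀ → Fin n × Fin n → ℂ), (∀ j, ∃ c : Fin n → ℂ, X n (tr (w j) (u j) (v j)) = ∑ k : Fin n, c k • ((K n)^[(k : ℕ)]) (tr (w j) (u j) (v j))) ∧ (∀ i, K n (tr (w' i) (u' i) (v' i)) = tr (w' i) (u' i) (v' i) ∧ X n (tr (w' i) (u'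 i) (v' i)) = 0) ∧ mm n = (∑ j, ∑ k : Fin n, ((K n)^[(k : ℕ)]) (tr (w j) (u j) (v j))) + ∑ i, tr (w' i) (u' i) (v' i)) ∧ (let wt : (n : ℕ) → Fin n × Fin n → ℂ := fun n p => Complex.exp (2 * Real.pi * Complex.I / n) ^ ((p.1 : ℤ) - (p.2 : ℤ)); let tr := fun {n : ℕ} (w u v : Fin n × Fin n → ℂ) => Literature.Computability.AlgebraicComplexity.triad w u v; let mm := fun n : ℕ => Literature.Computability.AlgebraicComplexity.matMulTensor ℂ n n n; let K := fun (n : ℕ) (t : (Fin n × Fin n → Fin n × Fin n → Fin n × Fin n → ℂ)) (a b c : Fin n × Fin n) => wt n a * (wt n b)⁻¹ * (wt n c)⁻¹ * t a b c; let X := fun (n : ℕ) (t : (Fin n × Fin n → Fin n × Fin n → Fin n × Fin n → ℂ)) (a b c : Fin n × Fin n) => (wt n b)⁻¹ * (wt n c)⁻¹ * ((∑ l : Fin n, if (l : ℕ) + 1 = (a.2 : ℕ) then t (a.1, l) b c else 0) - ∑ l : Fin n, if (a.1 : ℕ) + 1 = (l : ℕ) then wt n (l, a.2) * t (l, a.2)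 b c else 0) - (wt n b)⁻¹ * ((∑ μ : Fin n, if (b.2 : ℕ) + 1 = (μ : ℕ) then t a (b.1, μ) c else 0) - ∑ k : Fin n, if (k : ℕ) + 1 = (b.1 : ℕ) then wt n b * t a (k, b.2) c else 0) - (wt n b)⁻¹ * (wt n c)⁻¹ * ((∑ μ : Fin n, if (c.2 : ℕ) + 1 = (μ : ℕ) then t a b (c.1, μ) else 0) - ∑ k : Fin n, if (k : ℕ) + 1 = (c.1 : ℕ) then wt n c * t a b (k, c.2) else 0); let St := fun (n r : ℕ) (w u v : Fin r → Fin n × Fin n → ℂ) => mm n = ∑ s, tr (w s) (u s) (v s) ∧ (∃ c : Fin r → Fin r → ℂ, ∀ s, K n (tr (w s) (u s) (v s)) = ∑ s', c s s' • tr (w s') (u s') (v s')) ∧ (∃ c : Fin r → Fin r → ℂ, ∀ s, X n (tr (w s) (u s) (v s)) = ∑ s', c s s' • tr (w s') (u s') (v s')); ∃ r : ℕ, r ≤ 23 ∧ ∃ (w u v : Fin r → Fin 3 × Fin 3 → ℂ), St 3 r w u v)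

/-- item stmt-MatrixMultiplication-16130 · crux · rank 2 · open · by planner
why it might fail: counting: s ≤ n^(1+ε) seeds must supply n³ − r₀ support cells through orbits of length n while δ-closure (codimension 5 of 12 per seed at n = 2) is imposed; invariant rank-ones are scarce (weight-zero, δ-killed), so r₀ = n^(2+ε) of them may not exist either.
sources: Strassen1969, arXiv:1708.09398, arXiv:1801.00843, Montgomery1993Hopf
[crux] the DESIGN form of X (orbit sums of δ-closed seeds): for every ε > 0 there are n ≥ 2, s seeds
and r₀ invariant terms with n·s + r₀ ≤ n^(2+ε), rank-one tensors t_j (j < s) each Taft-CLOSED (𝒳 t_j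
∈ span of its Z_n-orbit 𝒦^k t_j, k < n — a projective uniserial T_n-module) and rank-one
Taft-INVARIANT tensors t'_i (𝒦 t'_i = t'_i, 𝒳 t'_i = 0), with ⟨n,n,n⟩ = Σ_j Σ_k 𝒦^k t_j + Σ_i t'_i.
(Strassen at n = 2: s = 3, r₀ = 1, the identity term.) Implies X by support SeedToScheme (𝒦^n = id
and 𝒳𝒦 = ω𝒦𝒳 on tensors, checked). [difficulty: open-problem] -/
@[route_item "route-MatrixMultiplication-TaftSchemes", crux]
def TaftSeedSchemes : Prop :=
  let wt : (n : ℕ) → Fin n × Fin n → ℂ := fun n p => Complex.exp (2 * Real.pi * Complex.I / n) ^ ((p.1 : ℤ) - (p.2 : ℤ)); let tr := fun {n : ℕ} (w u v : Fin n × Fin n → ℂ) => Literature.Computability.AlgebraicComplexity.triad w u v; let mm := fun n : ℕ => Literature.Computability.AlgebraicComplexity.matMulTensor ℂ n n n; let K := fun (n : ℕ) (t : (Fin n × Fin n → Fin n × Fin n → Fin n × Fin n → ℂ)) (a b c : Fin n × Fin n) => wt n a * (wt n b)⁻¹ * (wt n c)⁻¹ * t a b c; let X := fun (n : ℕ) (t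 : (Fin n × Fin n → Fin n × Fin n → Fin n × Fin n → ℂ)) (a b c : Fin n × Fin n) => (wt n b)⁻¹ * (wt n c)⁻¹ * ((∑ l : Fin n, if (l : ℕ) + 1 = (a.2 : ℕ) then t (a.1, l) b c else 0) - ∑ l : Fin n, if (a.1 : ℕ) + 1 = (l : ℕ) then wt n (l, a.2) * t (l, a.2) b c else 0) - (wt n b)⁻¹ * ((∑ μ : Fin n, if (b.2 : ℕ) + 1 = (μ : ℕ) then t a (b.1, μ) c else 0) - ∑ k : Fin n, if (k : ℕ) + 1 = (b.1 : ℕ) then wt n b * t a (k, b.2) c else 0) - (wt n b)⁻¹ * (wt n c)⁻¹ * ((∑ μ : Fin n, if (c.2 : ℕ) + 1 = (μ : ℕ) then t a b (c.1, μ) else 0) - ∑ k : Fin n, if (k : ℕ) + 1 = (c.1 : ℕ) then wt n c * t a b (k, c.2) else 0); ∀ ε : ℝ, 0 < ε → ∃ n : ℕ, 2 ≤ n ∧ ∃ s r₀ : ℕ, ((n * s + r₀ : ℕ) : ℝ) ≤ (n : ℝ) ^ (2 + ε) ∧ ∃ (w u v : Fin s → Fin n × Fin n → ℂ) (w' u'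 v' : Fin r₀ → Fin n × Fin n → ℂ), (∀ j, ∃ c : Fin n → ℂ, X n (tr (w j) (u j) (v j)) = ∑ k : Fin n, c k • ((K n)^[(k : ℕ)]) (tr (w j) (u j) (v j))) ∧ (∀ i, K n (tr (w' i) (u' i) (v' i)) = tr (w' i) (u' i) (v' i) ∧ X n (tr (w' i) (u' i) (v' i)) = 0) ∧ mm n = (∑ j, ∑ k : Fin n, ((K n)^[(k : ℕ)]) (tr (w j) (u j) (v j))) + ∑ i, tr (w' i) (u' i) (v' i)

/-- item stmt-MatrixMultiplication-16131 · crux · rank 3 · open · by planner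
why it might fail: BILR's Z_3 is the cyclic permutation of the three factors, not a diagonal conjugation of order 3; no rank-23 scheme may admit the diagonal order-3 alignment at all, let alone δ-closure (then the ladder starts only at a longer length, and 24–27 is the informative window).
sources: Laderman1976, arXiv:1801.00843, Smirnov2013, HeuleKauersSeidl2021
[crux] sign of life at n = 3 (ω_3 = e^(2πi/3)): ⟨3,3,3⟩ has a Taft-stable scheme of length ≤ 23
(Laderman's count; rank ∈ [19,23] open). Equivalently some rank-≤23 decomposition has, at a point of
its PGL_3^3-isotropy orbit, a span stable under Ad(diag(1,ω,ω²))-twisting and the twisted derivation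
by e_12 + e_23 — first test: the BallardEtAl2018 families with Z_3 and Z_4 × Z_3 symmetry, then the
orbit-sum/closure search (kit job j019146: s seeds with δ-closed Z_3-orbits + r0 invariant terms, r
= 3s + r0 ∈ (27, 23, 21, 19)). [difficulty: M] -/
@[route_item "route-MatrixMultiplication-TaftSchemes"]
def TaftThree : Prop :=
  let wt : (n : ℕ) → Fin n × Fin n → ℂ := fun n p => Complex.exp (2 * Real.pi * Complex.I / n) ^ ((p.1 : ℤ) - (p.2 : ℤ)); let tr := fun {n : ℕ} (w u v : Fin n × Fin n → ℂ) => Literature.Computability.AlgebraicComplexity.triad w u v; let mm := fun n : ℕ => Literature.Computability.AlgebraicComplexity.matMulTensor ℂ n n n; let K := fun (n : ℕ) (t : (Fin n × Fin n → Fin n × Fin n → Fin n × Fin n → ℂ)) (a b c : Fin n × Fin n) => wt n a * (wt n b)⁻¹ * (wt n c)⁻¹ * t a b c; let X := fun (n : ℕ) (t : (Fin n × Fin n → Fin n × Fin n → Fin n × Fin n → ℂ)) (a b c : Fin n × Fin n) => (wt n b)⁻¹ * (wt n c)⁻¹ * ((∑ l : Fin n, if (l : ℕ) + 1 = (a.2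 : ℕ) then t (a.1, l) b c else 0) - ∑ l : Fin n, if (a.1 : ℕ) + 1 = (l : ℕ) then wt n (l, a.2) * t (l, a.2) b c else 0) - (wt n b)⁻¹ * ((∑ μ : Fin n, if (b.2 : ℕ) + 1 = (μ : ℕ) then t a (b.1, μ) c else 0) - ∑ k : Fin n, if (k : ℕ) + 1 = (b.1 : ℕ) then wt n b * t a (k, b.2) c else 0) - (wt n b)⁻¹ * (wt n c)⁻¹ * ((∑ μ : Fin n, if (c.2 : ℕ) + 1 = (μ : ℕ) then t a b (c.1, μ) else 0) - ∑ k : Fin n, if (k : ℕ) + 1 = (c.1 : ℕ) then wt n c * t a b (k, c.2) else 0); let St := fun (n r : ℕ) (w u v : Fin r → Fin n × Fin n → ℂ) => mm n = ∑ s, tr (w s) (u s) (v s) ∧ (∃ c : Fin r → Fin r → ℂ, ∀ s, K n (tr (w s) (u s) (v s)) = ∑ s', c s s' • tr (w s') (u s') (v s')) ∧ (∃ c : Fin r → Fin r → ℂ, ∀ s, X n (tr (w s) (u s) (v s)) = ∑ s', c s s' • tr (w s') (u s') (v s')); ∃ r : ℕ, r ≤ 23 ∧ ∃ (w u v : Fin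 r → Fin 3 × Fin 3 → ℂ), St 3 r w u v

/-- item stmt-MatrixMultiplication-16132 · support · rank 9 · open · by planner
sources: Strassen1969
[support] composition glue: the two cruxes give the target (conjunction introduction). [difficulty:
provable-now] -/
@[route_item "route-MatrixMultiplication-TaftSchemes"]
def ThesisOfCruxes : Prop :=
  TaftSeedSchemes → TaftThree → Thesis

/-- item stmt-MatrixMultiplication-16133 · support · rank 9 · open · by planner
sources: Strassen1969, Blaser2013
[support] the SPAN form of the design statement: for every ε > 0 some ⟨n,n,n⟩ (n ≥ 2) has a
Taft-stable scheme (span of the triads stable under 𝒦 and 𝒳) of length r ≤ n^(2+ε); implied by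
TaftSeedSchemes (SeedToScheme) and itself implying ω(ℂ) = 2 (rank ≤ r; this unit's Sketch2.lean
proves TaftExponentTwo → MatrixMultiplication sorry-free). [difficulty: open-problem] -/
@[route_item "route-MatrixMultiplication-TaftSchemes"]
def TaftExponentTwo : Prop :=
  let wt : (n : ℕ) → Fin n × Fin n → ℂ := fun n p => Complex.exp (2 * Real.pi * Complex.I / n) ^ ((p.1 : ℤ) - (p.2 : ℤ)); let tr := fun {n : ℕ} (w u v : Fin n × Fin n → ℂ) => Literature.Computability.AlgebraicComplexity.triad w u v; let mm := fun n : ℕ => Literature.Computability.AlgebraicComplexity.matMulTensor ℂ n n n; let K := fun (n : ℕ) (t : (Fin n × Fin n → Fin n × Fin n → Fin n × Fin n → ℂ)) (a b c : Fin n × Fin n) => wt n a * (wt n b)⁻¹ * (wt n c)⁻¹ * t a b c; let X := fun (n : ℕ) (t : (Fin n × Fin n → Fin n × Fin n → Fin n × Fin n → ℂ)) (a b c : Fin n × Fin n) => (wt n b)⁻¹ * (wt n c)⁻¹ * ((∑ l : Fin n, if (l : ℕ) + 1 = (a.2 : ℕ) then t (a.1, l) b c else 0) - ∑ l : Fin n,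 if (a.1 : ℕ) + 1 = (l : ℕ) then wt n (l, a.2) * t (l, a.2) b c else 0) - (wt n b)⁻¹ * ((∑ μ : Fin n, if (b.2 : ℕ) + 1 = (μ : ℕ) then t a (b.1, μ) c else 0) - ∑ k : Fin n, if (k : ℕ) + 1 = (b.1 : ℕ) then wt n b * t a (k, b.2) c else 0) - (wt n b)⁻¹ * (wt n c)⁻¹ * ((∑ μ : Fin n, if (c.2 : ℕ) + 1 = (μ : ℕ) then t a b (c.1, μ) else 0) - ∑ k : Fin n, if (k : ℕ) + 1 = (c.1 : ℕ) then wt n c * t a b (k, c.2) else 0); let St := fun (n r : ℕ) (w u v : Fin r → Fin n × Fin n → ℂ) => mm n = ∑ s, tr (w s) (u s) (v s) ∧ (∃ c : Fin r → Fin r → ℂ, ∀ s, K n (tr (w s) (u s) (v s)) = ∑ s', c s s' • tr (w s') (u s') (v s')) ∧ (∃ c : Fin r → Fin r → ℂ, ∀ s, X n (tr (w s) (u s) (v s)) = ∑ s', c s s' • tr (w s') (u s') (v s')); ∀ ε : ℝ, 0 < ε → ∃ n : ℕ, 2 ≤ n ∧ ∃ r : ℕ, (r : ℝ) ≤ (n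 : ℝ) ^ (2 + ε) ∧ ∃ (w u v : Fin r → Fin n × Fin n → ℂ), St n r w u v

/-- item stmt-MatrixMultiplication-16134 · support · rank 9 · open · by planner
sources: Montgomery1993Hopf, Strassen1969
[support] glue to the target: TaftSeedSchemes → TaftExponentTwo (the n·s + r₀ tensors 𝒦^k t_j, t'_i
are triads — 𝒦 acts diagonally leg by leg — they sum to ⟨n,n,n⟩, and their span is 𝒦-stable (𝒦^n =
id) and 𝒳-stable (𝒳𝒦 = ω𝒦𝒳, closure of the seeds, 𝒳 t'_i = 0)). [difficulty: provable-now] -/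
@[route_item "route-MatrixMultiplication-TaftSchemes"]
def SeedToScheme : Prop :=
  TaftSeedSchemes → TaftExponentTwo

/-- item stmt-MatrixMultiplication-16135 · support · rank 9 · open · by planner
sources: arXiv:1705.08740, arXiv:1801.00843, arXiv:1408.6273, Montgomery1993Hopf
[support] (equivalence with the summit; open-problem, not for provers) quantum-Borel symmetry is
asymptotically free: for every ε > 0 and infinitely many n, SOME decomposition of ⟨n,n,n⟩ of length
≤ n^ε·R(⟨n,n,n⟩) is Taft-stable (so X ⟺ ω = 2; the T_n-analogue of the symmetrisation question
behind SchurWeylEquivariant's SymmetrisationCheap, for a 2n-… n²-dimensional NON-semisimple algebra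
instead of S_N). [difficulty: open-problem] -/
@[route_item "route-MatrixMultiplication-TaftSchemes"]
def TaftClosureFree : Prop :=
  let wt : (n : ℕ) → Fin n × Fin n → ℂ := fun n p => Complex.exp (2 * Real.pi * Complex.I / n) ^ ((p.1 : ℤ) - (p.2 : ℤ)); let tr := fun {n : ℕ} (w u v : Fin n × Fin n → ℂ) => Literature.Computability.AlgebraicComplexity.triad w u v; let mm := fun n : ℕ => Literature.Computability.AlgebraicComplexity.matMulTensor ℂ n n n; let K := fun (n : ℕ) (t : (Fin n × Fin n → Fin n × Fin n → Fin n × Fin n → ℂ)) (a b c : Fin n × Fin n) => wt n a * (wt n b)⁻¹ * (wt n c)⁻¹ * t a b c; let X := fun (n : ℕ) (t : (Fin n × Fin n → Fin n × Fin n → Fin n × Fin n → ℂ)) (a b c : Fin n × Fin n) => (wt n b)⁻¹ * (wt n c)⁻¹ * ((∑ l : Fin n, if (l : ℕ) + 1 = (a.2 : ℕ) then t (a.1, l) b c else 0) - ∑ l : Fin n, if (a.1 : ℕ) + 1 = (l : ℕ) then wt n (l, a.2) * t (l, a.2) b c else 0) - (wt n b)⁻¹ * ((∑ μ : Fin n,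 if (b.2 : ℕ) + 1 = (μ : ℕ) then t a (b.1, μ) c else 0) - ∑ k : Fin n, if (k : ℕ) + 1 = (b.1 : ℕ) then wt n b * t a (k, b.2) c else 0) - (wt n b)⁻¹ * (wt n c)⁻¹ * ((∑ μ : Fin n, if (c.2 : ℕ) + 1 = (μ : ℕ) then t a b (c.1, μ) else 0) - ∑ k : Fin n, if (k : ℕ) + 1 = (c.1 : ℕ) then wt n c * t a b (k, c.2) else 0); let St := fun (n r : ℕ) (w u v : Fin r → Fin n × Fin n → ℂ) => mm n = ∑ s, tr (w s) (u s) (v s) ∧ (∃ c : Fin r → Fin r → ℂ, ∀ s, K n (tr (w s) (u s) (v s)) = ∑ s', c s s' • tr (w s') (u s') (v s')) ∧ (∃ c : Fin r → Fin r → ℂ, ∀ s, X n (tr (w s) (u s) (v s)) = ∑ s', c s s' • tr (w s') (u s') (v s')); ∀ ε : ℝ, 0 < ε → ∀ n₀ : ℕ, ∃ n : ℕ, n₀ ≤ n ∧ ∃ r : ℕ, (r : ℝ) ≤ (n : ℝ) ^ ε * (Literature.Computability.AlgebraicComplexity.tensorRank (mm n) : ℝ) ∧ ∃ (w u v : Fin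 r → Fin n × Fin n → ℂ), St n r w u v

/-- item stmt-MatrixMultiplication-16136 · support · rank 9 · open · by planner
sources: arXiv:2506.13131, Strassen1969, arXiv:1408.6273
[support] second rung (support; staffed by anyone idle): ⟨4,4,4⟩ (ω_4 = i) has a Taft-stable scheme
of length ≤ 48 < 49 = 7²: the first square format below Strassen's power, where the record length-48
schemes over ℂ (AlphaEvolve 2025, coefficients in ℤ[i]/2) are genuinely complex — and i is exactly
the Taft parameter at n = 4. First test: the stabiliser of the published 48-scheme (arXiv:2506.13131
and its successors) for an order-4 diagonal element, then the closure search. [difficulty: M] -/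
@[route_item "route-MatrixMultiplication-TaftSchemes"]
def TaftFour48 : Prop :=
  let wt : (n : ℕ) → Fin n × Fin n → ℂ := fun n p => Complex.exp (2 * Real.pi * Complex.I / n) ^ ((p.1 : ℤ) - (p.2 : ℤ)); let tr := fun {n : ℕ} (w u v : Fin n × Fin n → ℂ) => Literature.Computability.AlgebraicComplexity.triad w u v; let mm := fun n : ℕ => Literature.Computability.AlgebraicComplexity.matMulTensor ℂ n n n; let K := fun (n : ℕ) (t : (Fin n × Fin n → Fin n × Fin n → Fin n × Fin n → ℂ)) (a b c : Fin n × Fin n) => wt n a * (wt n b)⁻¹ * (wt n c)⁻¹ * t a b c; let X := fun (n : ℕ) (t : (Fin n × Fin n → Fin n × Fin n → Fin n × Fin n → ℂ)) (a b c : Fin n × Fin n) => (wt n b)⁻¹ * (wt n c)⁻¹ * ((∑ l : Fin n, if (l : ℕ) + 1 = (a.2 : ℕ) then t (a.1, l) b c else 0) - ∑ l : Fin n, if (a.1 : ℕ) + 1 = (l : ℕ) then wt n (l, a.2) * t (l, a.2) b c else 0) - (wt n b)⁻¹ * ((∑ μ : Fin n, if (b.2 : ℕ) + 1 = (μ : ℕ)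 then t a (b.1, μ) c else 0) - ∑ k : Fin n, if (k : ℕ) + 1 = (b.1 : ℕ) then wt n b * t a (k, b.2) c else 0) - (wt n b)⁻¹ * (wt n c)⁻¹ * ((∑ μ : Fin n, if (c.2 : ℕ) + 1 = (μ : ℕ) then t a b (c.1, μ) else 0) - ∑ k : Fin n, if (k : ℕ) + 1 = (c.1 : ℕ) then wt n c * t a b (k, c.2) else 0); let St := fun (n r : ℕ) (w u v : Fin r → Fin n × Fin n → ℂ) => mm n = ∑ s, tr (w s) (u s) (v s) ∧ (∃ c : Fin r → Fin r → ℂ, ∀ s, K n (tr (w s) (u s) (v s)) = ∑ s', c s s' • tr (w s') (u s') (v s')) ∧ (∃ c : Fin r → Fin r → ℂ, ∀ s, X n (tr (w s) (u s) (v s)) = ∑ s', c s s' • tr (w s') (u s') (v s')); ∃ r : ℕ, r ≤ 48 ∧ ∃ (w u v : Fin r → Fin 4 × Fin 4 → ℂ), St 4 r w u v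

/-- item stmt-MatrixMultiplication-16137 · support · rank 9 · open · by planner
sources: Strassen1969, arXiv:1708.09398, Montgomery1993Hopf
[support] Strassen's scheme is Taft-stable at n = 2: the explicit rational witness (NOTES.md of this
unit; entries in {0, ±1, ±1/2}) sums to ⟨2,2,2⟩, 𝒦 permutes its terms (t1 fixed; t2↔t5, t3↔t4,
t6↔t7) and 𝒳t1 = 0, 𝒳t2 = −(t2+t5)/2 = −𝒳t5, 𝒳t3 = (t3+t4)/2 = −𝒳t4, 𝒳t6 = −(t6+t7)/2 = −𝒳t7 (span ≅
𝟙 ⊕ P³ over Sweedler's H_4). A finite identity over ℚ once exp(2πi/2) = −1 is rewritten; verified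
exactly outside Lean. [difficulty: provable-now] -/
@[route_item "route-MatrixMultiplication-TaftSchemes"]
def TaftTwo : Prop :=
  let wt : (n : ℕ) → Fin n × Fin n → ℂ := fun n p => Complex.exp (2 * Real.pi * Complex.I / n) ^ ((p.1 : ℤ) - (p.2 : ℤ)); let tr := fun {n : ℕ} (w u v : Fin n × Fin n → ℂ) => Literature.Computability.AlgebraicComplexity.triad w u v; let mm := fun n : ℕ => Literature.Computability.AlgebraicComplexity.matMulTensor ℂ n n n; let K := fun (n : ℕ) (t : (Fin n × Fin n → Fin n × Fin n → Fin n × Fin n → ℂ)) (a b c : Fin n × Fin n) => wt n a * (wt n b)⁻¹ * (wt n c)⁻¹ * t a b c; let X := fun (n : ℕ) (t : (Fin n × Fin n → Fin n × Fin n → Fin n × Fin n → ℂ)) (a b c : Fin n × Fin n) => (wt n b)⁻¹ * (wt n c)⁻¹ * ((∑ l : Fin n, if (l : ℕ) + 1 = (a.2 : ℕ) then t (a.1, l) b c else 0) - ∑ l : Fin n, if (a.1 : ℕ) + 1 = (l : ℕ) then wt n (l, a.2) * t (l, a.2) b c else 0) - (wt n b)⁻¹ * ((∑ μ : Fin n,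 if (b.2 : ℕ) + 1 = (μ : ℕ) then t a (b.1, μ) c else 0) - ∑ k : Fin n, if (k : ℕ) + 1 = (b.1 : ℕ) then wt n b * t a (k, b.2) c else 0) - (wt n b)⁻¹ * (wt n c)⁻¹ * ((∑ μ : Fin n, if (c.2 : ℕ) + 1 = (μ : ℕ) then t a b (c.1, μ) else 0) - ∑ k : Fin n, if (k : ℕ) + 1 = (c.1 : ℕ) then wt n c * t a b (k, c.2) else 0); let St := fun (n r : ℕ) (w u v : Fin r → Fin n × Fin n → ℂ) => mm n = ∑ s, tr (w s) (u s) (v s) ∧ (∃ c : Fin r → Fin r → ℂ, ∀ s, K n (tr (w s) (u s) (v s)) = ∑ s', c s s' • tr (w s') (u s') (v s')) ∧ (∃ c : Fin r → Fin r → ℂ, ∀ s, X n (tr (w s) (u s) (v s)) = ∑ s', c s s' • tr (w s') (u s') (v s')); ∃ (w u v : Fin 7 → Fin 2 × Fin 2 → ℂ), St 2 7 w u v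

/-- item stmt-MatrixMultiplication-16138 · support · rank 9 · open · by planner
sources: Montgomery1993Hopf, arXiv:1403.4673
[support] matrix multiplication is Taft-invariant for every n: 𝒦 m = m (weights telescope on the
support pattern) and 𝒳 m = 0 (the twisted Leibniz rule δ(PQ) = δ(P)g(Q) + Pδ(Q)). [difficulty:
provable-now] -/
@[route_item "route-MatrixMultiplication-TaftSchemes"]
def TaftInvariant : Prop :=
  let wt : (n : ℕ) → Fin n × Fin n → ℂ := fun n p => Complex.exp (2 * Real.pi * Complex.I / n) ^ ((p.1 : ℤ) - (p.2 : ℤ)); let mm := fun n : ℕ => Literature.Computability.AlgebraicComplexity.matMulTensor ℂ n n n; let K := fun (n : ℕ) (t : (Fin n × Fin n → Fin n × Fin n → Fin n × Fin n → ℂ)) (a b c : Fin n × Fin n) => wt n a * (wt n b)⁻¹ * (wt n c)⁻¹ * t a b c; let X := fun (n : ℕ) (t : (Fin n × Fin n → Fin n × Fin n → Fin n × Fin n → ℂ)) (a b c : Fin n × Fin n) => (wt n b)⁻¹ * (wt n c)⁻¹ * ((∑ l : Fin n, if (l : ℕ) + 1 = (a.2 : ℕ) then t (a.1, l) b c else 0)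 - ∑ l : Fin n, if (a.1 : ℕ) + 1 = (l : ℕ) then wt n (l, a.2) * t (l, a.2) b c else 0) - (wt n b)⁻¹ * ((∑ μ : Fin n, if (b.2 : ℕ) + 1 = (μ : ℕ) then t a (b.1, μ) c else 0) - ∑ k : Fin n, if (k : ℕ) + 1 = (b.1 : ℕ) then wt n b * t a (k, b.2) c else 0) - (wt n b)⁻¹ * (wt n c)⁻¹ * ((∑ μ : Fin n, if (c.2 : ℕ) + 1 = (μ : ℕ) then t a b (c.1, μ) else 0) - ∑ k : Fin n, if (k : ℕ) + 1 = (c.1 : ℕ) then wt n c * t a b (k, c.2) else 0); ∀ n : ℕ, K n (mm n) = mm n ∧ X n (mm n) = 0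

/-- item stmt-MatrixMultiplication-16139 · assembly · rank 1 · open · by planner
sources: Blaser2013, Strassen1969
[assembly] TaftSeedSchemes → MatrixMultiplication (the rank-2 crux alone decides: 𝒦-iterates of
triads are triads, so the orbit sums give a decomposition of length n·s + r₀ ≤ n^(2+ε), hence rank ≤
length and ω ≤ 2 + ε). -/
@[route_item "route-MatrixMultiplication-TaftSchemes"]
def Assembly : Prop :=
  TaftSeedSchemes → _root_.MatrixMultiplication

/-! D-0027 §2.1 — DECIDING THEOREM (planner-authored via `route open/edit --closes-file`; by planner-rrepair-MatrixMultiplication-TaftSchem-02620f72-0 2026-08-16T18:02:24Z):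
its hypotheses are this route's items and its conclusion the sub-problem Statement (glue_lint), and it elaborates with this file. -/

@[closes "route-MatrixMultiplication-TaftSchemes"] theorem closes (hS : TaftSeedSchemes) : _root_.MatrixMultiplication := by
  rw [_root_.MatrixMultiplication_iff]
  refine le_antisymm (le_of_forall_pos_lt_add ?_)
    (Literature.Computability.AlgebraicComplexity.omega_two_le ℂ)
  intro ε hε
  obtain ⟨n, hn, s, r₀, hsize, w, u, v, w', u', v', -, -, hdec⟩ := hS (ε / 2) (by positivity)
  -- local copies of the statement's abbreviations at this `n`
  let wt : Fin n × Fin n → ℂ := fun p => Complex.exp (2 * Real.pi * Complex.I / n) ^ ((p.1 : ℤ) - (p.2 : ℤ))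
  let Kn : (Fin n × Fin n → Fin n × Fin n → Fin n × Fin n → ℂ) → (Fin n × Fin n → Fin n × Fin n → Fin n × Fin n → ℂ) :=
    fun t a b c => wt a * (wt b)⁻¹ * (wt c)⁻¹ * t a b c
  -- iterates of 𝒦 on a triad are triads
  have hK : ∀ (x y z : Fin n × Fin n → ℂ) (k : ℕ), Kn^[k] (Literature.Computability.AlgebraicComplexity.triad x y z) =
      Literature.Computability.AlgebraicComplexity.triad (fun a => wt a ^ k * x a) (fun b => ((wt b)⁻¹) ^ k * y b) (fun c => ((wt c)⁻¹) ^ k * z c) := by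
    intro x y z k
    induction k with
    | zero =>
        funext a b c
        simp [Literature.Computability.AlgebraicComplexity.triad]
    | succ k ih =>
        rw [Function.iterate_succ_apply', ih]
        funext a b c
        simp only [Kn, Literature.Computability.AlgebraicComplexity.triad_apply, pow_succ]
        ring
  -- the decomposition, re-indexed by the finite type (Fin s × Fin n) ⊕ Fin r₀
  let W : (Fin s × Fin n) ⊕ Fin r₀ → Fin n × Fin n → ℂ := fun p => match p with
    | Sum.inl q => fun a => wt a ^ (q.2 : ℕ) * w q.1 a
    | Sum.inr i => w' i
  let U : (Fin s × Fin n) ⊕ Fin r₀ → Fin n × Fin n → ℂ := fun p => match p with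
    | Sum.inl q => fun b => ((wt b)⁻¹) ^ (q.2 : ℕ) * u q.1 b
    | Sum.inr i => u' i
  let V : (Fin s × Fin n) ⊕ Fin r₀ → Fin n × Fin n → ℂ := fun p => match p with
    | Sum.inl q => fun c => ((wt c)⁻¹) ^ (q.2 : ℕ) * v q.1 c
    | Sum.inr i => v' i
  have hdec' : Literature.Computability.AlgebraicComplexity.matMulTensor ℂ n n n =
      (∑ j : Fin s, ∑ k : Fin n, Kn^[(k : ℕ)] (Literature.Computability.AlgebraicComplexity.triad (w j) (u j) (v j)))
        + ∑ i : Fin r₀, Literature.Computability.AlgebraicComplexity.triad (w' i) (u' i) (v' i) := hdec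
  have hdec2 : Literature.Computability.AlgebraicComplexity.matMulTensor ℂ n n n =
      ∑ p : (Fin s × Fin n) ⊕ Fin r₀, Literature.Computability.AlgebraicComplexity.triad (W p) (U p) (V p) := by
    rw [Fintype.sum_sum_type, Fintype.sum_prod_type, hdec']
    congr 1
    refine Finset.sum_congr rfl fun j _ => Finset.sum_congr rfl fun k _ => ?_
    rw [hK]
  have hrank : Literature.Computability.AlgebraicComplexity.tensorRank (Literature.Computability.AlgebraicComplexity.matMulTensor ℂ n n n) ≤ s * n + r₀ := by
    have h := Literature.Computability.AlgebraicComplexity.tensorRank_le_card_of_eq_sum W U V hdec2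
    simpa [Fintype.card_sum, Fintype.card_prod, Fintype.card_fin] using h
  have hr : ((s * n + r₀ : ℕ) : ℝ) ≤ (n : ℝ) ^ (2 + ε / 2) := by
    have : s * n + r₀ = n * s + r₀ := by ring
    rw [this]; exact hsize
  -- Bläser 2013, Thm 5.9 in cubic form, from the DISCHARGED fact `Blaser2013Thm59_holds` (proved in tree)
  have hω : Literature.Computability.AlgebraicComplexity.omega ℂ ≤ Real.logb n (s * n + r₀ : ℕ) :=
    Literature.Computability.AlgebraicComplexity.omega_le_logb_of_rank_le'
      Literature.Computability.AlgebraicComplexity.Blaser2013Thm59_holds ℂ hn hrank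
  have hn1 : (1 : ℝ) < n := by exact_mod_cast hn
  have hn0 : (0 : ℝ) < n := by positivity
  have hlog : Real.logb n (s * n + r₀ : ℕ) ≤ 2 + ε / 2 := by
    rcases Nat.eq_zero_or_pos (s * n + r₀) with h0 | hpos
    · rw [h0]; simp; linarith
    · have hr0 : (0 : ℝ) < (s * n + r₀ : ℕ) := by exact_mod_cast hpos
      calc Real.logb n (s * n + r₀ : ℕ) ≤ Real.logb n ((n : ℝ) ^ (2 + ε / 2)) :=
            Real.logb_le_logb_of_le hn1 hr0 hr
        _ = 2 + ε / 2 := Real.logb_rpow hn0 (ne_of_gt hn1)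
  linarith

end Summit.MatrixMultiplication.MatrixMultiplication.Theses.TaftSchemes
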